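import Summits.CriticalPhenomena.CardyFormulaZ2.Theorems.CardyIKTransportIKLinearTransportStubConditionalRSW
import Summits.CriticalPhenomena.CardyFormulaZ2.Theorems.CardyIKTransportIKMixedBoxCrossingStubHoneycombRSW
import Literature.Probability.Percolation.TriRSWChaining
import Literature.Probability.Percolation.TriPathCrossings

/-!
# `CardyIKTransport.IKLinearTransport` (stmt-CriticalPhenomena-5076), line `pinned-diagram-exchange`:
# the RING clause of `stub_IKFarRSW` for the `S = ∅` member (registered sub-goal `ikFarRSW_ring_empty`)

`stub_IKFarRSW` asks, for every aspect bound `k`, every column pattern `S` and every `w × h` box with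
`n ≤ w, h ≤ k n`, three events of `ν_S`-probability `≥ c_k`; the third is the black RING in dual form:
every WHITE monochromatic path (`monoPaths x false`) meeting the box `[a, a+w) × [b, b+h)` stays off
`farFrom a b w h n` (the cells at sup-distance `> n` from the box). This file proves that clause for the
`S = ∅` member, which is exactly site percolation on the triangular lattice `𝕋 = ℤ² + (1,-1)`:
`obs ∅ = (blackSet ∅ ·, univ)` (`crsw_obs_empty_eq`), `cellGraph univ = triGraph`
(`HoneycombStub.cellGraph_univ_adj_iff`), and `blackSet ∅` pushes the gauge measure to fair site percolation
(`stub_TriLawOfEmpty`, used through `crsw_νmix_empty_eq_map`).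

PROOF. (i) BLOCKING (deterministic, `ring_blocked`): if the colours carry black long-way `𝕋`-crossings of
the four strips of the rectangular frame between the box and `farFrom a b w h n` — horizontal crossings of
`[a-n, a+w+n-1] × [b+h-1, b+h+n-1]` and `[a-n, a+w+n-1] × [b-n, b]`, vertical crossings of
`[a-n, a] × [b-n, b+h+n-1]` and `[a+w-1, a+w+n-1] × [b-n, b+h+n-1]` — then a white `𝕋`-path from a box
cell to a far cell would share a cell with one of them (the tree's `PathIn.meets_annulus_crossings`,
`TriPathCrossings.lean`, the rectangular-annulus form of `siteCluster_subset_box_of_mem_triClosedFrame`):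
white ≠ black. (ii) PROBABILITY (`ring_frame_prob`): the four crossings are increasing events determined
by their strips, so Harris–FKG (`sitePercolation_harris'`) bounds the frame from below by the product of
the four strip probabilities, each a `triLRCrossingProb half L n` with `L ≤ (k+2) n`, bounded below
uniformly by RSW chaining on `𝕋` (`pow_mul_pow_le_triLRCrossingProb_of_le` fed with
`crsw_exists_le_triLRCrossingProb_long`). (iii) TRANSFER (`ikFarRSW_ring_empty`): `νmix ∅` is the image of
fair site percolation under `A ↦ (A, univ)`, and `Measure.le_map_apply`.

No definitions, no literature facts, no `sorry`.
-/

noncomputable section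

namespace Summit.CriticalPhenomena.CardyFormulaZ2.Theorems.IKLinearTransport.PinnedDiagramExchange.FarRSWFragments

open Summit.CriticalPhenomena.CardyFormulaZ2.Theorems.IKLinearTransport.PinnedDiagramExchange
open Summit.CriticalPhenomena.CardyFormulaZ2.Cruxes.IKMixedBoxCrossing.PairedMirrorExploration (HoneycombStub.cellGraph_univ_adj_iff)
open scoped Classical ENNReal
open Set MeasureTheory
open Literature.Probability.Percolation Literature.Probability.LatticeModels

/-! ## §1 Paths: chains of cells are `PathIn`-paths -/

/-- Every cell of a chain of cells of `A` is joined inside `A` to the first cell of the chain. [folklore] -/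
theorem ring_pathIn_head_of_chain {V : Type*} {G : SimpleGraph V} {A : Set V} :
    ∀ (c : V) (t : List V), List.IsChain G.Adj (c :: t) → (∀ s ∈ c :: t, s ∈ A) →
      ∀ x ∈ c :: t, PathIn G A c x
  | c, [], _, hA, x, hx => by
    rw [List.mem_singleton] at hx
    subst hx
    exact PathIn.refl (hA _ (List.mem_singleton_self _))
  | c, d :: t, hc, hA, x, hx => by
    obtain ⟨hcd, hc'⟩ := List.isChain_cons_cons.1 hc
    rcases List.mem_cons.1 hx with rfl | hx
    · exact PathIn.refl (hA _ List.mem_cons_self)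
    · exact (PathIn.of_adj (hA _ List.mem_cons_self) (hA _ (List.mem_cons_of_mem _ List.mem_cons_self))
        hcd).trans (ring_pathIn_head_of_chain d t hc' (fun s hs => hA s (List.mem_cons_of_mem _ hs)) x hx)

/-- Any two cells of a chain of cells of `A` are joined by a `G`-path inside `A`. [folklore] -/
theorem ring_pathIn_of_chain {V : Type*} {G : SimpleGraph V} {A : Set V} {l : List V}
    (hc : List.IsChain G.Adj l) (hA : ∀ s ∈ l, s ∈ A) {x y : V} (hx : x ∈ l) (hy : y ∈ l) :
    PathIn G A x y := by
  match l, hc, hA, hx, hy with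
  | [], _, _, hx, _ => exact absurd hx List.not_mem_nil
  | c :: t, hc, hA, hx, hy =>
    exact (ring_pathIn_head_of_chain c t hc hA x hx).symm.trans (ring_pathIn_head_of_chain c t hc hA y hy)

/-! ## §2 Blocking: four black strip crossings confine the white paths through the box -/

/-- THE FRAME EVENT of the `w × h` box at `(a, b)` at distance `m + 1`: black long-way `𝕋`-crossings of the
four strips (top, bottom: horizontal; left, right: vertical) of the rectangular frame
`[a-m-1, a+w+m] × [b-m-1, b+h+m]` minus the box interior, read on the colours. BLOCKING: on this event every
white chain of the all-anti triangulation meeting the box avoids `farFrom a b w h (m+1)`. [folklore] -/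
theorem ring_blocked (a b : ℤ) (w h m : ℕ) (A : Set (Site 2))
    (hT : A ∈ triHCross (a - m - 1) (b + h - 1) (w + 2 * m + 1) (m + 1))
    (hB : A ∈ triHCross (a - m - 1) (b - m - 1) (w + 2 * m + 1) (m + 1))
    (hL : A ∈ triVCross (a - m - 1) (b - m - 1) (m + 1) (h + 2 * m + 1))
    (hR : A ∈ triVCross (a + w - 1) (b - m - 1) (m + 1) (h + 2 * m + 1)) :
    ((A, (Set.univ : Set (Site 2))) : Obs) ∈
      {x : Obs | ∀ p ∈ monoPaths x false, (∃ u ∈ p, a ≤ u 0 ∧ u 0 < a + w ∧ b ≤ u 1 ∧ u 1 < b + h) →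
        ∀ v ∈ p, v ∉ farFrom a b w h (m + 1)} := by
  rintro p ⟨-, hchain, hwhite⟩ ⟨u, hu, huB⟩ v hv hvF
  -- the white `𝕋`-path from the box cell `u` to the far cell `v`
  have hchain' : List.IsChain triGraph.Adj p :=
    hchain.imp fun x y hxy => (HoneycombStub.cellGraph_univ_adj_iff x y).1 hxy
  have hW : ∀ s ∈ p, s ∈ Aᶜ := fun s hs hsA => by simpa using (hwhite s hs).1 hsA
  have hpath : PathIn triGraph Aᶜ u v := ring_pathIn_of_chain hchain' hW hu hv
  -- the black cells of the closed frame rectangle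
  set K : Set (Site 2) :=
    {z : Site 2 | a - m - 1 ≤ z 0 ∧ z 0 ≤ a + w + m ∧ b - m - 1 ≤ z 1 ∧ z 1 ≤ b + h + m} ∩ A with hK
  have hKb : ∀ z ∈ K, a - m - 1 ≤ z 0 ∧ z 0 ≤ a + w + m ∧ b - m - 1 ≤ z 1 ∧ z 1 ≤ b + h + m :=
    fun z hz => hz.1
  simp only [farFrom, Set.mem_setOf_eq] at hvF
  push_cast at hvF
  obtain ⟨z, hzW, hzK⟩ := PathIn.meets_annulus_crossings (A := Aᶜ) (K := K)
    (L₂ := a - m - 1) (L₁ := a) (R₁ := a + w - 1) (R₂ := a + w + m)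
    (B₂ := b - m - 1) (B₁ := b) (T₁ := b + h - 1) (T₂ := b + h + m)
    (by omega) (by omega) (by omega) (by omega) hKb
    (by obtain ⟨x, y, hx, hy, hp⟩ := hT
        refine ⟨x, y, hx, by rw [hy]; push_cast; ring, hp.mono ?_⟩
        rintro z ⟨hz, hzA⟩
        simp only [mem_triStrip] at hz
        push_cast at hz
        exact ⟨⟨by simp only [Set.mem_setOf_eq]; omega, hzA⟩, by simp only [Set.mem_setOf_eq]; omega⟩)
    (by obtain ⟨x, y, hx, hy, hp⟩ := hB
        refine ⟨x, y, hx, by rw [hy]; push_cast; ring, hp.mono ?_⟩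
        rintro z ⟨hz, hzA⟩
        simp only [mem_triStrip] at hz
        push_cast at hz
        exact ⟨⟨by simp only [Set.mem_setOf_eq]; omega, hzA⟩, by simp only [Set.mem_setOf_eq]; omega⟩)
    (by obtain ⟨x, y, hx, hy, hp⟩ := hL
        refine ⟨x, y, hx, by rw [hy]; push_cast; ring, hp.mono ?_⟩
        rintro z ⟨hz, hzA⟩
        simp only [mem_triStrip] at hz
        push_cast at hz
        exact ⟨⟨by simp only [Set.mem_setOf_eq]; omega, hzA⟩, by simp only [Set.mem_setOf_eq]; omega⟩)
    (by obtain ⟨x, y, hx, hy, hp⟩ := hR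
        refine ⟨x, y, hx, by rw [hy]; push_cast; ring, hp.mono ?_⟩
        rintro z ⟨hz, hzA⟩
        simp only [mem_triStrip] at hz
        push_cast at hz
        exact ⟨⟨by simp only [Set.mem_setOf_eq]; omega, hzA⟩, by simp only [Set.mem_setOf_eq]; omega⟩)
    (s := u) (by omega) (by omega) hpath
  exact hzW hzK.2

/-! ## §3 Probability of the frame under fair site percolation on `𝕋` -/

/-- RSW AT EVERY ASPECT RATIO for fair site percolation on `𝕋`: for every `k` there is `q > 0` with
`q ≤ P_{1/2}(LR_𝕋(L, m+1))` whenever `L ≤ (k+2)(m+1)` (chaining `pow_mul_pow_le_triLRCrossingProb_of_le` of the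
uniform bound `crsw_exists_le_triLRCrossingProb_long` for `(2m+3) × (m+1)` parallelograms). [folklore] -/
theorem ring_exists_rsw_aspect (k : ℕ) :
    ∃ q : ℝ, 0 < q ∧ ∀ (m L : ℕ), L ≤ (k + 2) * (m + 1) → q ≤ triLRCrossingProb half L (m + 1) := by
  obtain ⟨c, hc, hcross⟩ := crsw_exists_le_triLRCrossingProb_long
  refine ⟨c ^ (k + 1) * c ^ k, mul_pos (pow_pos hc _) (pow_pos hc _), fun m L hL => ?_⟩
  have h₁ : c ≤ triLRCrossingProb half (2 * (m + 1)) (m + 1) :=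
    (hcross (m + 1)).trans (triLRCrossingProb_anti_width half (by omega) (m + 1))
  have h₂ : c ≤ triLRCrossingProb half (m + 1) (m + 1) :=
    (hcross (m + 1)).trans (triLRCrossingProb_anti_width half (by omega) (m + 1))
  have := pow_mul_pow_le_triLRCrossingProb_of_le half (m + 1) hc.le hc.le h₁ h₂ (j := k + 1) (by omega)
    (w := L) (by simpa [add_assoc] using hL)
  simpa using this

/-- PROBABILITY OF THE FRAME (Harris–FKG, three times): under fair site percolation on `𝕋` the frame event
of `ring_blocked` has probability at least the product of the four strip-crossing probabilities. [folklore] -/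
theorem ring_frame_prob (a b : ℤ) (w h m : ℕ) :
    triLRCrossingProb half (w + 2 * m + 1) (m + 1) * triLRCrossingProb half (w + 2 * m + 1) (m + 1) *
        (triLRCrossingProb half (h + 2 * m + 1) (m + 1) * triLRCrossingProb half (h + 2 * m + 1) (m + 1)) ≤
      (sitePercolation (Site 2) half).real
        ((triHCross (a - m - 1) (b + h - 1) (w + 2 * m + 1) (m + 1) ∩
            triHCross (a - m - 1) (b - m - 1) (w + 2 * m + 1) (m + 1)) ∩
          (triVCross (a - m - 1) (b - m - 1) (m + 1) (h + 2 * m + 1) ∩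
            triVCross (a + w - 1) (b - m - 1) (m + 1) (h + 2 * m + 1))) := by
  have d1 := determinedBy_triHCross (a - m - 1) (b + h - 1) (w + 2 * m + 1) (m + 1)
  have d2 := determinedBy_triHCross (a - m - 1) (b - m - 1) (w + 2 * m + 1) (m + 1)
  have d3 := determinedBy_triVCross (a - m - 1) (b - m - 1) (m + 1) (h + 2 * m + 1)
  have d4 := determinedBy_triVCross (a + w - 1) (b - m - 1) (m + 1) (h + 2 * m + 1)
  have u1 := isUpperSet_triHCross (a - m - 1) (b + h - 1) (w + 2 * m + 1) (m + 1)
  have u2 := isUpperSet_triHCross (a - m - 1) (b - m - 1) (w + 2 * m + 1) (m + 1)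
  have u3 := isUpperSet_triVCross (a - m - 1) (b - m - 1) (m + 1) (h + 2 * m + 1)
  have u4 := isUpperSet_triVCross (a + w - 1) (b - m - 1) (m + 1) (h + 2 * m + 1)
  have e1 := triSitePercolation_real_triHCross half (a - m - 1) (b + h - 1) (w + 2 * m + 1) (m + 1)
  have e2 := triSitePercolation_real_triHCross half (a - m - 1) (b - m - 1) (w + 2 * m + 1) (m + 1)
  have e3 := triSitePercolation_real_triVCross half (a - m - 1) (b - m - 1) (m + 1) (h + 2 * m + 1)
  have e4 := triSitePercolation_real_triVCross half (a + w - 1) (b - m - 1) (m + 1) (h + 2 * m + 1)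
  have hH := sitePercolation_harris' half d1 d2 u1 u2
  have hV := sitePercolation_harris' half d3 d4 u3 u4
  have d12 : DeterminedBy (triHCross (a - m - 1) (b + h - 1) (w + 2 * m + 1) (m + 1) ∩
      triHCross (a - m - 1) (b - m - 1) (w + 2 * m + 1) (m + 1))
      ↑(triStripFinset (a - m - 1) (b + h - 1) (w + 2 * m + 1) (m + 1) ∪
        triStripFinset (a - m - 1) (b - m - 1) (w + 2 * m + 1) (m + 1)) := by
    rw [Finset.coe_union]
    exact (d1.mono Set.subset_union_left).inter (d2.mono Set.subset_union_right)
  have d34 : DeterminedBy (triVCross (a - m - 1) (b - m - 1) (m + 1) (h + 2 * m + 1) ∩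
      triVCross (a + w - 1) (b - m - 1) (m + 1) (h + 2 * m + 1))
      ↑(triStripFinset (a - m - 1) (b - m - 1) (m + 1) (h + 2 * m + 1) ∪
        triStripFinset (a + w - 1) (b - m - 1) (m + 1) (h + 2 * m + 1)) := by
    rw [Finset.coe_union]
    exact (d3.mono Set.subset_union_left).inter (d4.mono Set.subset_union_right)
  have hHV := sitePercolation_harris' half d12 d34 (u1.inter u2) (u3.inter u4)
  unfold triSitePercolation at e1 e2 e3 e4
  rw [e1, e2] at hH
  rw [e3, e4] at hV
  have h0 : ∀ L : ℕ, 0 ≤ triLRCrossingProb half L (m + 1) := fun L => measureReal_nonneg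
  calc _ ≤ (sitePercolation (Site 2) half).real
          (triHCross (a - m - 1) (b + h - 1) (w + 2 * m + 1) (m + 1) ∩
            triHCross (a - m - 1) (b - m - 1) (w + 2 * m + 1) (m + 1)) *
        (sitePercolation (Site 2) half).real
          (triVCross (a - m - 1) (b - m - 1) (m + 1) (h + 2 * m + 1) ∩
            triVCross (a + w - 1) (b - m - 1) (m + 1) (h + 2 * m + 1)) :=
        mul_le_mul hH hV (mul_nonneg (h0 _) (h0 _)) measureReal_nonneg
    _ ≤ _ := hHV

/-! ## §4 The registered sub-goal -/

/-- **THE RING CLAUSE OF `stub_IKFarRSW` FOR THE `S = ∅` MEMBER, EVERY ASPECT BOUND** (registered sub-goal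
`ikFarRSW_ring_empty` of stmt-CriticalPhenomena-5076): for every `k` there is `c > 0` such that for every
`n ≥ 1`, every position `(a, b)` and every `w × h` box with `n ≤ w ≤ k n`, `n ≤ h ≤ k n`, with
`ν_∅`-probability at least `c` every white monochromatic path meeting the box `[a, a+w) × [b, b+h)` stays
off `farFrom a b w h n`. Proof: the event contains the image of the frame event (`ring_blocked`), `νmix ∅` is
the image of fair site percolation on `𝕋` under `A ↦ (A, univ)` (`crsw_νmix_empty_eq_map` and
`stub_TriLawOfEmpty`), and the frame has probability `≥ q_k⁴` (`ring_frame_prob`, `ring_exists_rsw_aspect`: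
the four strips have aspect ratio `≤ k + 2`). -/
theorem ikFarRSW_ring_empty : ∀ k : ℕ, ∃ c : ℝ, 0 < c ∧ ∀ (n : ℕ) (a b : ℤ) (w h : ℕ), 1 ≤ n → n ≤ w → w ≤ k * n → n ≤ h → h ≤ k * n → c ≤ (νmix ∅).real {x | ∀ p ∈ monoPaths x false, (∃ u ∈ p, a ≤ u 0 ∧ u 0 < a + w ∧ b ≤ u 1 ∧ u 1 < b + h) → ∀ v ∈ p, v ∉ farFrom a b w h n} := by
  intro k
  obtain ⟨q, hq, hrsw⟩ := ring_exists_rsw_aspect k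
  refine ⟨(q * q) * (q * q), mul_pos (mul_pos hq hq) (mul_pos hq hq), fun n a b w h hn hnw hwk hnh hhk => ?_⟩
  obtain ⟨m, rfl⟩ : ∃ m, n = m + 1 := ⟨n - 1, by omega⟩
  -- the frame event and its probability
  set G : Set (Set (Site 2)) :=
    (triHCross (a - m - 1) (b + h - 1) (w + 2 * m + 1) (m + 1) ∩
        triHCross (a - m - 1) (b - m - 1) (w + 2 * m + 1) (m + 1)) ∩
      (triVCross (a - m - 1) (b - m - 1) (m + 1) (h + 2 * m + 1) ∩
        triVCross (a + w - 1) (b - m - 1) (m + 1) (h + 2 * m + 1)) with hG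
  have hw' : w + 2 * m + 1 ≤ (k + 2) * (m + 1) := by nlinarith
  have hh' : h + 2 * m + 1 ≤ (k + 2) * (m + 1) := by nlinarith
  have hPw := hrsw m _ hw'
  have hPh := hrsw m _ hh'
  have hGprob : (q * q) * (q * q) ≤ (sitePercolation (Site 2) half).real G :=
    (mul_le_mul (mul_le_mul hPw hPw hq.le measureReal_nonneg) (mul_le_mul hPh hPh hq.le measureReal_nonneg)
      (mul_nonneg hq.le hq.le) (mul_nonneg measureReal_nonneg measureReal_nonneg)).trans
      (ring_frame_prob a b w h m)
  -- the frame event is mapped into the ring event by `A ↦ (A, univ)`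
  set E : Set Obs := {x | ∀ p ∈ monoPaths x false,
    (∃ u ∈ p, a ≤ u 0 ∧ u 0 < a + w ∧ b ≤ u 1 ∧ u 1 < b + h) →
      ∀ v ∈ p, v ∉ farFrom a b w h (m + 1)} with hE
  have hsub : G ⊆ (fun A : Set (Site 2) => ((A, (Set.univ : Set (Site 2))) : Obs)) ⁻¹' E := by
    rintro A ⟨⟨hT, hB⟩, ⟨hL, hR⟩⟩
    exact ring_blocked a b w h m A hT hB hL hR
  -- transfer
  calc (q * q) * (q * q) ≤ (sitePercolation (Site 2) half).real G := hGprob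
    _ ≤ (sitePercolation (Site 2) half).real
          ((fun A : Set (Site 2) => ((A, (Set.univ : Set (Site 2))) : Obs)) ⁻¹' E) :=
        measureReal_mono hsub (measure_ne_top _ _)
    _ ≤ ((sitePercolation (Site 2) half).map
          (fun A : Set (Site 2) => ((A, (Set.univ : Set (Site 2))) : Obs))).real E := by
        rw [measureReal_def, measureReal_def]
        exact ENNReal.toReal_mono (measure_ne_top _ _)
          (Measure.le_map_apply measurable_prodMk_right.aemeasurable E)
    _ = (νmix ∅).real E := by rw [crsw_νmix_empty_eq_map stub_TriLawOfEmpty]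

end Summit.CriticalPhenomena.CardyFormulaZ2.Theorems.IKLinearTransport.PinnedDiagramExchange.FarRSWFragments

end
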